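import Summits.Ventures.AbcSig.Levels.N98K13
import Summits.Ventures.AbcSig.Recipes.KrausTable

/-!
# Venture AbcSig — level 98 = 2·7², exponent 13: the certificates of `Levels/N98K13.lean` RE-CHECKED against the GENERATED Kraus table

HONEST FRAMING. Kernel certificates of the COMPUTATION cell `pub-abcsig`; no Diophantine statement, no claim on ABC or any summit. The orbit data
and sieve certificates are those of `Levels/N98K13.lean` (unchanged, imported); the only difference is the allowed-trace function: instead of the
transcribed table `krausAllowed_C7_v_n13` (DATA, hypothesis `RefinedTraces`), the VALUE `krausTableAt .E3 1 1 7 13 [53, 79, 131]` of the computable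
generator (`Recipes/KrausTable.lean`; auxiliary primes 53, 79, 131 ≡ 1 (mod 13), `bs04Allowed` elsewhere), whose soundness for actual solutions is
PROVED (`Recipes/FreyTracePackage.lean`, `freyTrace_mem_krausTable`). The kernel evaluates the generator at the primes where the trees split
(3 and 53 here; whole file ≈ 10 s). Consumed by `Rows/X13Y13eq7Z2P.lean`.
-/

namespace Summit.Ventures.AbcSig

/-- Kernel check, against the GENERATED Kraus table, of the certificate for `98.1`. -/
theorem cert_98_1_k13_checkP : cert_98_1_k13.check orbit_98_1_k13 (krausTableAt .E3 1 1 7 13 [53, 79, 131]) = true := by decide +kernel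
/-- `98.1` is eliminated for every prime exponent outside [2, 3]. -/
theorem orbit_98_1_k13_eliminatedP (n : ℕ) (hn : n.Prime) (h : n ∉ ([2, 3] : List ℕ)) :
    orbit_98_1_k13.Eliminated (krausTableAt .E3 1 1 7 13 [53, 79, 131]) n :=
  cert_98_1_k13.check_sound orbit_98_1_k13 (krausTableAt .E3 1 1 7 13 [53, 79, 131]) cert_98_1_k13_checkP n hn (by simpa [cert_98_1_k13] using h)

/-- Kernel check, against the GENERATED Kraus table, of the certificate for `98.2`. -/
theorem cert_98_2_k13_checkP : cert_98_2_k13.check orbit_98_2_k13 (krausTableAt .E3 1 1 7 13 [53, 79, 131]) = true := by decide +kernel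
/-- `98.2` is eliminated for every prime exponent outside [2, 7]. -/
theorem orbit_98_2_k13_eliminatedP (n : ℕ) (hn : n.Prime) (h : n ∉ ([2, 7] : List ℕ)) :
    orbit_98_2_k13.Eliminated (krausTableAt .E3 1 1 7 13 [53, 79, 131]) n :=
  cert_98_2_k13.check_sound orbit_98_2_k13 (krausTableAt .E3 1 1 7 13 [53, 79, 131]) cert_98_2_k13_checkP n hn (by simpa [cert_98_2_k13] using h)

/-- **Level 98 summary.** For a prime exponent `n ≥ 13`, every orbit of level 98 is sieve-eliminated by the
kernel certificates above, except that the row's predicate `X` (a cited exclusion, or anything when `n` is excluded by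
the row) is assumed for: (nothing). Union of residual exponents ≥ 13: ∅. -/
theorem level98k13_sieveP (n : ℕ) (hn : n.Prime) (hmin : 13 ≤ n) (X : OrbitData → Prop) :
    ∀ o ∈ level98k13Orbits, (∀ e ∈ o.coeffs, e.ell.Prime ∧ e.ell ≠ 2 ∧ ¬ e.ell ∣ 98) ∧ (o.Eliminated (krausTableAt .E3 1 1 7 13 [53, 79, 131]) n ∨ X o) := by
  intro o ho
  refine ⟨level98k13_wellformed o ho, ?_⟩
  simp only [level98k13Orbits, List.mem_cons, List.not_mem_nil, or_false] at ho
  rcases ho with rfl | rfl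
  · exact Or.inl (orbit_98_1_k13_eliminatedP n hn (by simp only [List.mem_cons, List.not_mem_nil, or_false]; omega))
  · exact Or.inl (orbit_98_2_k13_eliminatedP n hn (by simp only [List.mem_cons, List.not_mem_nil, or_false]; omega))


end Summit.Ventures.AbcSig
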